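import Literature.Barriers.ABC.SzpiroEpsilonCannotBeDroppedHolds
import Literature.Barriers.ABC.EpsilonCannotBeDroppedHolds
import Literature.NumberTheory.EllipticCurves.SzpiroOfAbcProofs
import HarnessLib

/-!
# Masser's quantitative theorem (`24 − δ`), proved: `masser1990_lowerBound_holds`

Third sibling proof file of `SzpiroEpsilonCannotBeDropped.lean` (D-0014; barrier audit D-0021 of
2026-08-15); theorems only, no new definitions, no named facts. It DISCHARGES the barrier file's
quantitative named fact `Literature.Barriers.ABC.masser1990_lowerBound` (Masser 1990, Theorem, in
the iso-class form reported by Bennett–Yazdani 2012, eq. (6)) and proves Masser's Theorem in its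
printed form (`Masser.masser_theorem`: for every `δ > 0` and `N₀` a semistable elliptic `E/ℚ` with
`N > N₀` and `|Δ_min| ≥ N^6 exp((24 − δ)(log N)^{1/2}(log log N)^{−1})`), completing the discharge
of the entry begun in `SzpiroEpsilonCannotBeDroppedHolds.lean` (polylogarithmic form).

## Source and proof followed

* D. W. Masser, *Note on a conjecture of Szpiro*, Astérisque 183 (1990), 19–23 (held, Numdam
  `AST_1990__183__19_0`) [cite: Masser1990, Theorem, Lemma 1, Proposition]. Theorem (p. 19) as
  above; Lemma 1 (pp. 19–20): the Frey curve `y² = x(x − a)(x + b)` of coprime `a + b + c = 0`,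
  `a ≡ 1 (mod 4)`, `32 ∣ c` has `|D| = 2^{−8}(abc)²`, `N = S(abc)`; Proposition (p. 20): coprime
  `a + b + c = 0` with the congruences and `|abc| ≥ S³ exp((12 − δ)(log S)^{1/2}(log log S)^{−1})`,
  `S = S(abc) > S₀`; proof (pp. 21–23): Stewart–Tijdeman's odd `y`-smooth integers `≤ x`,
  `y = (log x)^{1/2}`, `t + 1` of them in one class modulo `2^n p` (`p` the least prime `> y`), a
  consecutive pair with `x_i < 2x_{i−1}` (7), `S(ab) ≤ e^{θ(y)}`, `S(c) ≤ 2^{1−n}|c|` (8),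
  `|abc| ≥ ½|c|³`, and `S < x^{1+δ}`.
* The smooth-number count and the prime number theorem inputs are those of the tree's proof of
  Stewart–Tijdeman (`EpsilonCannotBeDroppedHolds.lean`, Bombieri–Gubler 12.4.8–12.4.10
  [cite: BombieriGubler2006, 12.4.10]): `StewartTijdeman.exists_smooth_finset`,
  `StewartTijdeman.log_factorial_le`, `StewartTijdeman.eventually_primeCounting_bounds`,
  `StewartTijdeman.eventually_primeCounting_mul_log_sub_theta_ge`,
  `StewartTijdeman.eventually_log_sq_le`, `StewartTijdeman.sqrt_div_log_mono`.

## What is proved, and two harmless deviations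

* `Masser.exists_balanced_triple_of_modEq`, `Masser.exists_balanced_triple_of_card_lt` — Masser's
  modification as a second pigeonhole coordinate: among more than `m (⌊log₂ T⌋ + 1)` smooth numbers
  `≤ T` two lie in one residue class mod `m` AND one dyadic block, `n < n' < 2n`, and the gcd step
  gives a BALANCED abc triple `b < a < c < 2a` with `m ∣ b` (Masser instead takes `t + 1` numbers in
  one class and a consecutive close pair; the dyadic coordinate costs the same `O(log y)`).
* `Masser.exists_curve_quant` — for `0 < η ≤ 1` and large `y`: a semistable `E` (the Frey curve of
  the balanced triple, via the tree's discharged `conductorNorm_freyCurve_of_mod_holds`,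
  `minimalDiscriminantNorm_freyCurve_of_mod_holds`, `isSemistable_freyCurve_of_mod_holds`, packaged
  as `Masser.exists_frey_curve`) with `q ∣ N` for a Bertrand prime `q ∈ (y, 2y]` (Masser's
  `p > y`, making `N > y`), `log N ≤ y² + 2y`, and `log|Δ_min| ≥ 6 log N + (12 − η) y/log y`
  (`|Δ_min|/N^6 = 2^{−8}(abc)²/rad(abc)^6 ≥ 2^{−8}(b/rad(abc))^6` and
  `log b − log rad(abc) ≥ log 2^k − log 2 − ϑ(y) ≥ (2 − O(ε)) y/log y`, with `ε = η/64`).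
* `Masser.masser_theorem` — the printed Theorem (with Lemma 1's semistability), by
  `√(log N)/log log N ≤ (y + 1)/(2 log y)` (monotonicity of `√u/log u` on `[e², ∞)`).
* `masser1990_lowerBound_holds : masser1990_lowerBound` — the iso-class form, since the conductor is
  a `VariableChange ℚ`-invariant (the tree's
  `WeierstrassCurve.conductorNorm_smul_rat`).
-/

noncomputable section

open Literature.NumberTheory.DiophantineGeometry UniqueFactorizationMonoid Finset
open Filter Asymptotics WeierstrassCurve

namespace Literature.Barriers.ABC

namespace Masser

/-! ### The balanced gcd step and the dyadic pigeonhole for smooth numbers -/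

/-- **Masser's balanced gcd step** (Bombieri–Gubler 12.4.10 with Masser's (7)): if `0 < n < n' < 2n`
are congruent modulo `m` and all prime factors of `n n'` lie in a set `P` of primes none of which
divides `m`, then with `d = gcd(n, n')` the triple `a = n/d`, `b = (n' − n)/d`, `c = n'/d` is an abc
triple with `c ≤ n'`, `m ∣ b`, `c < 2a` (so `b < a < c`), prime factors of `a`, `c` in `P`, and
`rad(abc) · m ≤ (∏_{p∈P} p) · rad(m) · b`.
[cite: Masser1990, Proof of Proposition, (7)–(8)] [cite: BombieriGubler2006, 12.4.10] -/
theorem exists_balanced_triple_of_modEq {P : Finset ℕ} (hP : ∀ p ∈ P, p.Prime) {m n n' : ℕ}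
    (hm : 0 < m) (hn0 : 0 < n) (hlt : n < n') (h2n : n' < 2 * n) (hmod : n ≡ n' [MOD m])
    (hn : n.primeFactors ⊆ P) (hn' : n'.primeFactors ⊆ P) (hPm : ∀ p ∈ P, ¬ p ∣ m) :
    ∃ a b c : ℕ, IsABCTriple a b c ∧ c ≤ n' ∧ m ∣ b ∧ c < 2 * a ∧
      a.primeFactors ⊆ P ∧ c.primeFactors ⊆ P ∧
      rad a b c * m ≤ (∏ p ∈ P, p) * radical m * b := by
  have hn'0 : 0 < n' := lt_trans hn0 hlt
  set d := Nat.gcd n n' with hd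
  have hd0 : 0 < d := Nat.gcd_pos_of_pos_left _ hn0
  have hdn : d ∣ n := Nat.gcd_dvd_left _ _
  have hdn' : d ∣ n' := Nat.gcd_dvd_right _ _
  set a := n / d with ha
  set c := n' / d with hc
  have hda : d * a = n := Nat.mul_div_cancel' hdn
  have hdc : d * c = n' := Nat.mul_div_cancel' hdn'
  have ha0 : 0 < a := Nat.div_pos (Nat.le_of_dvd hn0 hdn) hd0
  have hac : a < c := Nat.div_lt_div_of_lt_of_dvd hdn' hlt
  have hc2a : c < 2 * a := by
    have h1 : d * c < d * (2 * a) := by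
      rw [hdc, mul_left_comm, hda]; exact h2n
    exact Nat.lt_of_mul_lt_mul_left h1
  have hcop : Nat.Coprime a c := Nat.coprime_div_gcd_div_gcd hd0
  set b := c - a with hb
  have hb0 : 0 < b := by omega
  have habc : a + b = c := by omega
  have hcopab : Nat.Coprime a b := (Nat.coprime_sub_self_right hac.le).mpr hcop
  -- `m ∣ b`
  have hdvd_sub : m ∣ n' - n := (Nat.modEq_iff_dvd' hlt.le).mp hmod
  have hsub : n' - n = d * b := by rw [hb, Nat.mul_sub, hdc, hda]
  have hcopmd : Nat.Coprime m d := by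
    refine Nat.coprime_of_dvd fun q hq hqm hqd => ?_
    have hqn : q ∣ n := dvd_trans hqd hdn
    exact hPm q (hn (Nat.mem_primeFactors.mpr ⟨hq, hqn, hn0.ne'⟩)) hqm
  have hmb : m ∣ b := by
    rw [hsub] at hdvd_sub
    exact hcopmd.dvd_of_dvd_mul_left hdvd_sub
  obtain ⟨b', hb'⟩ := hmb
  have hb'0 : 0 < b' := by
    rcases Nat.eq_zero_or_pos b' with h | h
    · rw [h, mul_zero] at hb'; omega
    · exact h
  -- every prime factor of `abc` divides `K = (∏ P) * rad m * b'`
  have hprod0 : (∏ p ∈ P, p) ≠ 0 := prod_ne_zero_iff.mpr fun p hp => (hP p hp).ne_zero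
  set K : ℕ := (∏ p ∈ P, p) * radical m * b' with hK
  have hK0 : K ≠ 0 := Nat.mul_ne_zero (Nat.mul_ne_zero hprod0 radical_ne_zero) hb'0.ne'
  have ha_dvd : a ∣ n := ⟨d, by rw [mul_comm, hda]⟩
  have hc_dvd : c ∣ n' := ⟨d, by rw [mul_comm, hdc]⟩
  have haP : a.primeFactors ⊆ P := (Nat.primeFactors_mono ha_dvd hn0.ne').trans hn
  have hcP : c.primeFactors ⊆ P := (Nat.primeFactors_mono hc_dvd hn'0.ne').trans hn'
  have hPdvd : ∀ q, q ∈ P → q ∣ ∏ p ∈ P, p := fun q hq => dvd_prod_of_mem _ hq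
  have hrad_dvd : radical (a * b * c) ∣ K := by
    rw [Nat.radical_dvd_iff hK0]
    intro q hq
    rw [Nat.mem_primeFactors] at hq ⊢
    obtain ⟨hqprime, hqdvd, -⟩ := hq
    refine ⟨hqprime, ?_, hK0⟩
    rcases (Nat.Prime.dvd_mul hqprime).mp hqdvd with h | h
    · rcases (Nat.Prime.dvd_mul hqprime).mp h with h' | h'
      · have hqP : q ∈ P := hn (Nat.mem_primeFactors.mpr ⟨hqprime, dvd_trans h' ha_dvd, hn0.ne'⟩)
        exact dvd_mul_of_dvd_left (dvd_mul_of_dvd_left (hPdvd q hqP) _) _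
      · rw [hb'] at h'
        rcases (Nat.Prime.dvd_mul hqprime).mp h' with h'' | h''
        · have hqrad : q ∣ radical m := by
            rw [Nat.radical_eq_prod_primeFactors]
            exact dvd_prod_of_mem _ (Nat.mem_primeFactors.mpr ⟨hqprime, h'', hm.ne'⟩)
          exact dvd_mul_of_dvd_left (dvd_mul_of_dvd_right hqrad _) _
        · exact dvd_mul_of_dvd_right h'' _
    · have hqP : q ∈ P := hn' (Nat.mem_primeFactors.mpr ⟨hqprime, dvd_trans h hc_dvd, hn'0.ne'⟩)
      exact dvd_mul_of_dvd_left (dvd_mul_of_dvd_left (hPdvd q hqP) _) _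
  have hrad_le : radical (a * b * c) ≤ K := Nat.le_of_dvd (Nat.pos_of_ne_zero hK0) hrad_dvd
  refine ⟨a, b, c, ⟨ha0, hb0, habc, hcopab⟩, Nat.div_le_self _ _, ⟨b', hb'⟩, hc2a, haP, hcP, ?_⟩
  calc rad a b c * m = radical (a * b * c) * m := rfl
    _ ≤ K * m := Nat.mul_le_mul_right _ hrad_le
    _ = (∏ p ∈ P, p) * radical m * b := by rw [hK, hb']; ring

/-- **Dirichlet's pigeonhole with a dyadic coordinate (Masser's variant of Bombieri–Gubler
12.4.10).** If more than `m · (⌊log₂ T⌋ + 1)` positive integers `≤ T` with all prime factors in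
`P` (primes not dividing `m`) are given, two of them, `n < n' < 2n`, are congruent modulo `m` and lie
in the same dyadic block, and the balanced gcd step applies.
[cite: Masser1990, Proof of Proposition] [cite: BombieriGubler2006, 12.4.10] -/
theorem exists_balanced_triple_of_card_lt {P S : Finset ℕ} (hP : ∀ p ∈ P, p.Prime) {m T : ℕ}
    (hm : 0 < m) (hS : ∀ s ∈ S, 0 < s ∧ s ≤ T ∧ s.primeFactors ⊆ P) (hPm : ∀ p ∈ P, ¬ p ∣ m)
    (hcard : m * (Nat.log 2 T + 1) < S.card) :
    ∃ a b c : ℕ, IsABCTriple a b c ∧ c ≤ T ∧ m ∣ b ∧ c < 2 * a ∧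
      a.primeFactors ⊆ P ∧ c.primeFactors ⊆ P ∧
      rad a b c * m ≤ (∏ p ∈ P, p) * radical m * b := by
  classical
  have hlt_card : (range m ×ˢ range (Nat.log 2 T + 1)).card < S.card := by
    rwa [card_product, card_range, card_range]
  have hmaps : Set.MapsTo (fun s : ℕ => (s % m, Nat.log 2 s)) (S : Set ℕ)
      ((range m ×ˢ range (Nat.log 2 T + 1) : Finset (ℕ × ℕ)) : Set (ℕ × ℕ)) := by
    intro s hs
    have hs' := (hS s (mem_coe.mp hs))
    refine mem_coe.mpr (mem_product.mpr ⟨mem_range.mpr (Nat.mod_lt _ hm), mem_range.mpr ?_⟩)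
    show Nat.log 2 s < Nat.log 2 T + 1
    exact Nat.lt_succ_of_le (Nat.log_mono_right hs'.2.1)
  obtain ⟨s₁, hs₁, s₂, hs₂, hne, heq⟩ := exists_ne_map_eq_of_card_lt_of_maps_to hlt_card hmaps
  simp only [Prod.mk.injEq] at heq
  obtain ⟨hmodeq, hlog⟩ := heq
  have close : ∀ {u v : ℕ}, 0 < u → Nat.log 2 u = Nat.log 2 v → v < 2 * u := by
    intro u v hu h
    have h1 : v < 2 ^ (Nat.log 2 v + 1) := Nat.lt_pow_succ_log_self one_lt_two v
    have h2 : 2 ^ Nat.log 2 u ≤ u := Nat.pow_log_le_self 2 hu.ne'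
    rw [← h, pow_succ] at h1
    omega
  have key : ∀ {u v : ℕ}, u ∈ S → v ∈ S → u < v → v < 2 * u → u ≡ v [MOD m] →
      ∃ a b c : ℕ, IsABCTriple a b c ∧ c ≤ T ∧ m ∣ b ∧ c < 2 * a ∧
        a.primeFactors ⊆ P ∧ c.primeFactors ⊆ P ∧
        rad a b c * m ≤ (∏ p ∈ P, p) * radical m * b := by
    intro u v hu hv huv h2 hmod
    obtain ⟨a, b, c, habc, hcv, hmb, hc2a, haP, hcP, hrad⟩ :=
      exists_balanced_triple_of_modEq hP hm (hS u hu).1 huv h2 hmod (hS u hu).2.2 (hS v hv).2.2 hPm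
    exact ⟨a, b, c, habc, hcv.trans (hS v hv).2.1, hmb, hc2a, haP, hcP, hrad⟩
  rcases lt_or_gt_of_ne hne with h | h
  · exact key hs₁ hs₂ h (close (hS s₁ hs₁).1 hlog) hmodeq
  · exact key hs₂ hs₁ h (close (hS s₂ hs₂).1 hlog.symm) (Nat.ModEq.symm hmodeq)


/-! ### Masser's family, quantitative form -/

/-- Numerical constant: `log 2 < 0.6931471808` gives `log 384 < 7`, `log 48 < 4.2`,
`log 256 < 5.6`, `log 4 < 1.4`, `log 6 < 2.1`, `log 8 < 2.1`. [folklore] -/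
theorem log_consts :
    Real.log 384 < 7 ∧ Real.log 48 < 4.2 ∧ Real.log 256 < 5.6 ∧ Real.log 4 < 1.4 ∧
      Real.log 6 < 2.1 ∧ Real.log 8 < 2.1 := by
  have h2 := Real.log_two_lt_d9
  have hmono : ∀ {a b : ℝ}, 0 < a → a ≤ b → Real.log a ≤ Real.log b :=
    fun ha hab => Real.log_le_log ha hab
  have hpow : ∀ n : ℕ, Real.log ((2 : ℝ) ^ n) = n * Real.log 2 := fun n => Real.log_pow 2 n
  refine ⟨?_, ?_, ?_, ?_, ?_, ?_⟩
  · have := hmono (by norm_num : (0:ℝ) < 384) (by norm_num : (384 : ℝ) ≤ 2 ^ 10)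
    rw [hpow] at this; push_cast at this; linarith
  · have := hmono (by norm_num : (0:ℝ) < 48) (by norm_num : (48 : ℝ) ≤ 2 ^ 6)
    rw [hpow] at this; push_cast at this; linarith
  · have : Real.log 256 = Real.log ((2 : ℝ) ^ 8) := by norm_num
    rw [this, hpow]; push_cast; linarith
  · have : Real.log 4 = Real.log ((2 : ℝ) ^ 2) := by norm_num
    rw [this, hpow]; push_cast; linarith
  · have := hmono (by norm_num : (0:ℝ) < 6) (by norm_num : (6 : ℝ) ≤ 2 ^ 3)
    rw [hpow] at this; push_cast at this; linarith
  · have : Real.log 8 = Real.log ((2 : ℝ) ^ 3) := by norm_num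
    rw [this, hpow]; push_cast; linarith

set_option maxHeartbeats 800000 in
open StewartTijdeman in
/-- **Masser's Proposition and Lemma 1, quantitative form (proved).** For `0 < η ≤ 1` and all
large `y ∈ ℕ` there is a semistable elliptic curve `E/ℚ` — the Frey curve of a balanced abc triple
`b < a < c < 2a` built from two odd `y`-smooth integers `≤ x = e^{y²}` in one residue class modulo
`2^k q` (`q` a prime in `(y, 2y]`) and one dyadic block — with `q ∣ N_E` (so `N_E > y`),
`log N_E ≤ y² + 2y` and `log|Δ_min| ≥ 6 log N_E + (12 − η) y/log y`: as in Stewart–Tijdeman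
(Bombieri–Gubler 12.4.10) the number `M` of odd `y`-smooth integers up to `x` satisfies
`log M − ϑ(y) ≥ (2 − O(ε)) y/log y` (Stirling and the prime number theorem), the dyadic coordinate
and the prime `q` cost only `O(log y)`, and `|Δ_min|/N^6 = 2^{−8}(abc/rad(abc)³)² ≥ 2^{−8}(b/rad(abc))⁶`.
[cite: Masser1990, Lemma 1, Proposition and its proof] [cite: BombieriGubler2006, 12.4.10] -/
theorem exists_curve_quant {η : ℝ} (hη : 0 < η) (hη1 : η ≤ 1) :
    ∃ y₀ : ℕ, ∀ y : ℕ, y₀ ≤ y → ∃ W : WeierstrassCurve ℚ, W.IsElliptic ∧ W.IsSemistable ℤ ∧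
      y < W.conductorNorm ℤ ∧
      Real.log (W.conductorNorm ℤ) ≤ (y : ℝ) ^ 2 + 2 * y ∧
      6 * Real.log (W.conductorNorm ℤ) + (12 - η) * y / Real.log y ≤
        Real.log (W.minimalDiscriminantNorm ℤ) := by
  set ε : ℝ := η / 64 with hεdef
  have hε : 0 < ε := by positivity
  have hε64 : ε ≤ 1 / 64 := by rw [hεdef]; linarith
  have hε1 : ε ≤ 1 := by linarith
  -- the prime number theorem (three consequences) and two growth facts, for all large real `y`
  have hev : ∀ᶠ y : ℝ in atTop,
      ((1 - ε) * (y / Real.log y) ≤ (Nat.primeCounting ⌊y⌋₊ : ℝ) ∧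
        (Nat.primeCounting ⌊y⌋₊ : ℝ) ≤ (1 + ε) * (y / Real.log y)) ∧
      ((1 - ε) * (y / Real.log y) ≤
          (Nat.primeCounting ⌊y⌋₊ : ℝ) * Real.log y - Chebyshev.theta y ∧
        (Real.log y ^ 2 ≤ ε * y ∧ Real.exp 4 ≤ y)) :=
    (eventually_primeCounting_bounds hε).and
      ((eventually_primeCounting_mul_log_sub_theta_ge hε hε1).and
        ((eventually_log_sq_le hε).and (eventually_ge_atTop _)))
  obtain ⟨y₁, hy₁⟩ := Filter.eventually_atTop.mp hev
  refine ⟨max ⌈y₁⌉₊ 3, fun y hy => ?_⟩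
  have hy3 : 3 ≤ y := le_trans (le_max_right _ _) hy
  have hyy₁ : y₁ ≤ (y : ℝ) :=
    le_trans (Nat.le_ceil y₁) (by exact_mod_cast le_trans (le_max_left _ _) hy)
  obtain ⟨⟨hπge, hπle⟩, hE3, hE4, hexp4⟩ := hy₁ y hyy₁
  rw [Nat.floor_natCast] at hπge hπle hE3
  -- abbreviations: `L = log y`, `Y = y / log y`
  set yr : ℝ := (y : ℝ) with hyr
  set L : ℝ := Real.log yr with hL
  set πy : ℝ := (Nat.primeCounting y : ℝ) with hπy
  have hyr3 : (3 : ℝ) ≤ yr := by rw [hyr]; exact_mod_cast hy3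
  have hyr0 : 0 < yr := by linarith
  have hyr1 : 1 ≤ yr := by linarith
  have hL4 : 4 ≤ L := by
    rw [hL, ← Real.log_exp 4]; exact Real.log_le_log (Real.exp_pos 4) hexp4
  have hL0 : 0 < L := by linarith
  set Y : ℝ := yr / L with hY
  have hY0 : 0 < Y := div_pos hyr0 hL0
  have hYL : Y * L = yr := by rw [hY]; field_simp
  have hLY : L ≤ ε * Y := by
    rw [hY, ← mul_div_assoc, le_div_iff₀ hL0]
    calc L * L = L ^ 2 := (sq L).symm
      _ ≤ ε * yr := hE4
  have hεY4 : 4 ≤ ε * Y := hL4.trans hLY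
  have hεY64 : ε * Y ≤ Y / 64 := by
    have := mul_le_mul_of_nonneg_right hε64 hY0.le; linarith
  have hY256 : 256 ≤ Y := by linarith
  -- the odd primes up to `y`
  set P : Finset ℕ := (Nat.primesLE y).erase 2 with hPdef
  have hPprime : ∀ p ∈ P, p.Prime := fun p hp => (Nat.mem_primesLE.mp (mem_of_mem_erase hp)).2
  have hPle : ∀ p ∈ P, p ≤ y := fun p hp => (Nat.mem_primesLE.mp (mem_of_mem_erase hp)).1
  have hPne2 : ∀ p ∈ P, p ≠ 2 := fun p hp => ne_of_mem_erase hp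
  have hP3 : 3 ∈ P := mem_erase.mpr ⟨by norm_num, Nat.mem_primesLE.mpr ⟨hy3, Nat.prime_three⟩⟩
  have h2mem : 2 ∈ Nat.primesLE y := Nat.mem_primesLE.mpr ⟨by omega, Nat.prime_two⟩
  set n : ℕ := P.card with hndef
  have hncard : n = Nat.primeCounting y - 1 := by
    rw [hndef, hPdef, card_erase_of_mem h2mem, Nat.primesLE_card_eq_primeCounting]
  have hn1 : 1 ≤ n := card_pos.mpr ⟨3, hP3⟩
  have hπ1 : 1 ≤ Nat.primeCounting y := by
    rw [← Nat.primesLE_card_eq_primeCounting]; exact card_pos.mpr ⟨2, h2mem⟩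
  have hnR : (n : ℝ) = πy - 1 := by
    rw [hncard, Nat.cast_sub hπ1, Nat.cast_one]
  have hn0R : (0 : ℝ) < n := by exact_mod_cast hn1
  -- the odd `y`-smooth numbers up to `x = e^{y²}`
  set X : ℝ := Real.exp (yr ^ 2) with hXdef
  have hX1 : 1 ≤ X := Real.one_le_exp (by positivity)
  have hX0 : 0 < X := by linarith
  have hlogX : Real.log X = yr ^ 2 := Real.log_exp _
  obtain ⟨S, hSmem, hSbound⟩ := exists_smooth_finset P hPprime X
  have hScard := hSbound hX1
  rw [hlogX] at hScard
  set Pl : ℝ := ∏ p ∈ P, Real.log p with hPl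
  have hlogp : ∀ p ∈ P, 0 < Real.log (p : ℝ) := fun p hp =>
    Real.log_pos (by exact_mod_cast (hPprime p hp).one_lt)
  have hPl0 : 0 < Pl := prod_pos hlogp
  set B : ℝ := (yr ^ 2) ^ n / ((n.factorial : ℝ) * Pl) with hB
  have hB0 : 0 < B := by positivity
  set NS : ℕ := S.card with hNS
  have hBN : B ≤ (NS : ℝ) := hScard
  -- `log B ≥ n L − n ε + n − L/2 − 1` (Stirling, `log log p ≤ log L`, `log n ≤ ε + L − log L`)
  have hlogB : Real.log B = 2 * n * L - Real.log (n.factorial : ℝ) -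
      ∑ p ∈ P, Real.log (Real.log p) := by
    rw [hB, Real.log_div (by positivity) (by positivity), Real.log_mul (by positivity) hPl0.ne',
      Real.log_pow, Real.log_pow, hPl, Real.log_prod (fun p hp => (hlogp p hp).ne')]
    push_cast
    ring
  have hSt : Real.log (n.factorial : ℝ) ≤ n * Real.log n - n + Real.log n / 2 + 1 :=
    log_factorial_le hn1
  have hsum : ∑ p ∈ P, Real.log (Real.log p) ≤ n * Real.log L := by
    have h : ∀ p ∈ P, Real.log (Real.log (p : ℝ)) ≤ Real.log L := by
      intro p hp
      have hp2 : (2 : ℝ) ≤ p := by exact_mod_cast (hPprime p hp).two_le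
      have hpy : (p : ℝ) ≤ yr := by rw [hyr]; exact_mod_cast hPle p hp
      exact Real.log_le_log (hlogp p hp) (Real.log_le_log (by linarith) hpy)
    calc ∑ p ∈ P, Real.log (Real.log (p : ℝ)) ≤ ∑ p ∈ P, Real.log L := sum_le_sum h
      _ = n * Real.log L := by rw [sum_const, nsmul_eq_mul, hndef]
  have hnπ : (n : ℝ) ≤ πy := by rw [hnR]; linarith
  have hlogY : Real.log Y = L - Real.log L := by
    rw [hY, Real.log_div hyr0.ne' hL0.ne']
  have hlogn : Real.log n ≤ ε + L - Real.log L := by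
    have h1 : (n : ℝ) ≤ (1 + ε) * Y := hnπ.trans hπle
    have h2 : Real.log n ≤ Real.log ((1 + ε) * Y) := Real.log_le_log hn0R h1
    rw [Real.log_mul (by linarith) hY0.ne', hlogY] at h2
    have h3 : Real.log (1 + ε) ≤ ε := by
      have := Real.log_le_sub_one_of_pos (by linarith : (0 : ℝ) < 1 + ε); linarith
    linarith
  have hlogL1 : 1 ≤ Real.log L := by
    rw [← Real.log_exp 1]
    refine Real.log_le_log (Real.exp_pos 1) ?_
    have := Real.exp_one_lt_d9
    linarith
  have hlogBge : (n : ℝ) * L - n * ε + n - L / 2 - 1 ≤ Real.log B := by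
    rw [hlogB]
    have h1 : (n : ℝ) * Real.log n ≤ n * (ε + L - Real.log L) :=
      mul_le_mul_of_nonneg_left hlogn hn0R.le
    have h2 : 0 ≤ (n : ℝ) * Real.log L - Real.log n / 2 := by
      have : Real.log n ≤ L := by linarith
      nlinarith [hlogL1, hn0R, this, hL0]
    linarith
  -- consequences: `n ≥ (1 − ε) Y − 1 ≥ 251`, `log B ≥ 250 L`
  have hnY : (1 - ε) * Y - 1 ≤ n := by rw [hnR]; linarith
  have hn251 : (251 : ℝ) ≤ n := by linarith [hY256, hεY64, hnY]
  have hlogB250 : 250 * L ≤ Real.log B := by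
    have h1 : (n : ℝ) * (L - ε + 1) - L / 2 - 1 ≤ Real.log B := by linarith
    have h2 : 251 * (L - ε + 1) ≤ (n : ℝ) * (L - ε + 1) :=
      mul_le_mul_of_nonneg_right hn251 (by linarith)
    linarith [h1, h2, hL4, hε64]
  obtain ⟨hl384, hl48, hl256, hl4, hl6, hl8⟩ := log_consts
  -- a prime `q ∈ (y, 2y]` (Bertrand)
  obtain ⟨q, hq, hyq, hq2y⟩ := Nat.exists_prime_lt_and_le_two_mul y (by omega)
  have hq0 : 0 < q := hq.pos
  have hqR : (q : ℝ) ≤ 2 * yr := by rw [hyr]; exact_mod_cast hq2y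
  have hq0R : (0 : ℝ) < q := by exact_mod_cast hq0
  -- the dyadic blocks: `T = ⌊X⌋`, `Bk = ⌊log₂ T⌋ + 1 ≤ 3 y²`
  set T : ℕ := ⌊X⌋₊ with hT
  have hT1 : 1 ≤ T := Nat.le_floor (by exact_mod_cast hX1)
  have hTX : (T : ℝ) ≤ X := Nat.floor_le hX0.le
  have hST : ∀ s ∈ S, 0 < s ∧ s ≤ T ∧ s.primeFactors ⊆ P := fun s hs =>
    ⟨(hSmem s hs).1, Nat.le_floor (hSmem s hs).2.1, (hSmem s hs).2.2⟩
  set Bk : ℕ := Nat.log 2 T + 1 with hBk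
  have hBk0 : 0 < Bk := Nat.succ_pos _
  have hBkR : (Bk : ℝ) ≤ 3 * yr ^ 2 := by
    have h1 : ((2 ^ Nat.log 2 T : ℕ) : ℝ) ≤ T := by exact_mod_cast Nat.pow_log_le_self 2 (by omega)
    have h2 : (Nat.log 2 T : ℝ) * Real.log 2 ≤ yr ^ 2 := by
      have := Real.log_le_log (by positivity) (h1.trans hTX)
      rw [hlogX] at this
      push_cast at this
      rwa [Real.log_pow] at this
    have hl2 : (1 / 2 : ℝ) < Real.log 2 := by
      have := Real.log_two_gt_d9; linarith
    have h3 : (Nat.log 2 T : ℝ) ≤ 2 * yr ^ 2 := by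
      have : (Nat.log 2 T : ℝ) * (1 / 2) ≤ (Nat.log 2 T : ℝ) * Real.log 2 :=
        mul_le_mul_of_nonneg_left hl2.le (Nat.cast_nonneg _)
      linarith
    have h4 : (1 : ℝ) ≤ yr ^ 2 := by nlinarith
    rw [hBk]; push_cast; linarith
  -- `U = q · Bk`, `64 U ≤ NS`
  set U : ℕ := q * Bk with hU
  have hU0 : 0 < U := Nat.mul_pos hq0 hBk0
  have hU0R : (0 : ℝ) < U := by exact_mod_cast hU0
  have hlogU : Real.log U ≤ 2.1 + 3 * L := by
    have h1 : (U : ℝ) ≤ 6 * yr ^ 3 := by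
      rw [hU]; push_cast
      calc (q : ℝ) * Bk ≤ (2 * yr) * (3 * yr ^ 2) := by gcongr
        _ = 6 * yr ^ 3 := by ring
    have := Real.log_le_log hU0R h1
    rw [Real.log_mul (by norm_num) (by positivity), Real.log_pow] at this
    push_cast at this
    linarith
  have hNS0R : (0 : ℝ) < NS := lt_of_lt_of_le hB0 hBN
  have hNS0 : 0 < NS := by exact_mod_cast hNS0R
  have h64U : 64 * U ≤ NS := by
    have h1 : Real.log ((64 * U : ℕ) : ℝ) ≤ Real.log NS := by
      push_cast
      rw [Real.log_mul (by norm_num) hU0R.ne']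
      have : Real.log (64 : ℝ) ≤ 7 := by
        have := Real.log_le_log (by norm_num : (0:ℝ) < 64) (by norm_num : (64:ℝ) ≤ 384); linarith
      have h2 : Real.log B ≤ Real.log NS := Real.log_le_log hB0 hBN
      linarith
    have h64U0 : (0 : ℝ) < ((64 * U : ℕ) : ℝ) := by push_cast; positivity
    exact_mod_cast (Real.log_le_log_iff h64U0 hNS0R).mp h1
  -- the modulus `m = 2^k q` with `2^k U ≤ NS/2`, `NS < 4 · 2^k · U`, `k ≥ 5`
  set R : ℕ := NS / U with hR
  have hR64 : 64 ≤ R := (Nat.le_div_iff_mul_le hU0).mpr h64U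
  set k₀ : ℕ := Nat.log 2 R with hk₀
  have hk₀6 : 6 ≤ k₀ := Nat.le_log_of_pow_le one_lt_two (by norm_num; exact hR64)
  set k : ℕ := k₀ - 1 with hk
  have hk5 : 5 ≤ k := by omega
  have hkk₀ : k₀ = k + 1 := by omega
  set m₂ : ℕ := 2 ^ k with hm₂
  have hm₂0 : 0 < m₂ := pow_pos two_pos k
  set m : ℕ := m₂ * q with hm
  have hm0 : 0 < m := Nat.mul_pos hm₂0 hq0
  have hcount : m * Bk < NS := by
    have h1 : 2 ^ k₀ ≤ R := Nat.pow_log_le_self 2 (by omega)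
    have h2 : 2 ^ k₀ * U ≤ NS := (Nat.mul_le_mul_right U h1).trans (Nat.div_mul_le_self NS U)
    rw [hkk₀, pow_succ] at h2
    have h3 : m * Bk = 2 ^ k * U := by rw [hm, hm₂, hU]; ring
    rw [h3]
    have h4 : 0 < 2 ^ k * U := Nat.mul_pos (pow_pos two_pos k) hU0
    have h5 : 2 ^ k * 2 * U = 2 ^ k * U + 2 ^ k * U := by ring
    omega
  have hNSlt : (NS : ℝ) < 4 * m₂ * U := by
    have h1 : R < 2 ^ (k₀ + 1) := Nat.lt_pow_succ_log_self one_lt_two R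
    have h2 : NS < (R + 1) * U := by
      have := Nat.lt_div_mul_add (a := NS) hU0
      rw [← hR] at this
      linarith [this]
    have h3 : (R + 1) * U ≤ 2 ^ (k₀ + 1) * U := Nat.mul_le_mul_right U h1
    have h4 : 2 ^ (k₀ + 1) = 4 * m₂ := by rw [hkk₀, hm₂]; ring
    have h5 : NS < 4 * m₂ * U := by rw [← h4]; exact lt_of_lt_of_le h2 h3
    exact_mod_cast h5
  -- no prime of `P` divides `m`
  have hPm : ∀ p ∈ P, ¬ p ∣ m := by
    intro p hp hdvd
    rcases (Nat.Prime.dvd_mul (hPprime p hp)).mp hdvd with h | h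
    · exact hPne2 p hp ((Nat.prime_dvd_prime_iff_eq (hPprime p hp) Nat.prime_two).mp
        ((hPprime p hp).dvd_of_dvd_pow h))
    · have : p = q := (Nat.prime_dvd_prime_iff_eq (hPprime p hp) hq).mp h
      have := hPle p hp
      omega
  -- pigeonhole with the dyadic coordinate, balanced gcd step
  obtain ⟨a, b, c, habc, hcT, hmb, hc2a, haP, -, hradm⟩ :=
    exists_balanced_triple_of_card_lt hPprime hm0 hST hPm hcount
  obtain ⟨ha0, hb0, hsumabc, hcop⟩ := habc
  have hba : b ≤ a := by omega
  have hbc : b < c := by omega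
  have hc0 : 0 < c := by omega
  -- `rad(m) ≤ 2q`, hence `rad(abc) · 2^k ≤ 2 Q b`
  set Q : ℕ := ∏ p ∈ P, p with hQ
  have hQpos : 0 < Q := prod_pos fun p hp => (hPprime p hp).pos
  have hradm2q : radical m ≤ 2 * q := by
    have hdvd : radical m ∣ 2 * q := by
      rw [Nat.radical_dvd_iff (by positivity)]
      intro r hr
      obtain ⟨hrprime, hrdvd, -⟩ := Nat.mem_primeFactors.mp hr
      refine Nat.mem_primeFactors.mpr ⟨hrprime, ?_, by positivity⟩
      rcases (Nat.Prime.dvd_mul hrprime).mp hrdvd with h | h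
      · have := (Nat.prime_dvd_prime_iff_eq hrprime Nat.prime_two).mp (hrprime.dvd_of_dvd_pow h)
        subst this; exact dvd_mul_right 2 q
      · exact dvd_mul_of_dvd_right h 2
    exact Nat.le_of_dvd (by positivity) hdvd
  have hkey : rad a b c * m₂ ≤ 2 * Q * b := by
    have h1 : rad a b c * m₂ * q ≤ 2 * Q * b * q := by
      calc rad a b c * m₂ * q = rad a b c * m := by rw [hm]; ring
        _ ≤ Q * radical m * b := hradm
        _ ≤ Q * (2 * q) * b := Nat.mul_le_mul_right _ (Nat.mul_le_mul_left _ hradm2q)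
        _ = 2 * Q * b * q := by ring
    exact Nat.le_of_mul_le_mul_right h1 hq0
  -- `∏_{p ∈ P} p ≤ e^{ϑ(y)}`
  have hlogQ : Real.log (Q : ℝ) ≤ Chebyshev.theta yr := by
    rw [hyr, Chebyshev.theta_eq_sum_primesLE_log y, hQ, Nat.cast_prod,
      Real.log_prod (fun p hp => ?_)]
    · refine sum_le_sum_of_subset_of_nonneg (erase_subset _ _) fun p hp _ => ?_
      exact Real.log_natCast_nonneg p
    · exact_mod_cast (hPprime p hp).ne_zero
  have hθ : Chebyshev.theta yr ≤ 2 * yr := by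
    have h0 : 0 ≤ (1 - ε) * Y := by
      have : 0 ≤ 1 - ε := by linarith
      positivity
    have h1 : Chebyshev.theta yr ≤ πy * L := by linarith [hE3, h0]
    have h2 : πy * L ≤ (1 + ε) * Y * L := mul_le_mul_of_nonneg_right hπle hL0.le
    rw [mul_assoc, hYL] at h2
    have h3 : ε * yr ≤ 1 * yr := mul_le_mul_of_nonneg_right hε1 hyr0.le
    linarith
  -- the Frey curve
  have ha2 : ¬ 2 ∣ a := fun h2a =>
    hPne2 2 (haP (Nat.mem_primeFactors.mpr ⟨Nat.prime_two, h2a, ha0.ne'⟩)) rfl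
  have hm₂b : m₂ ∣ b := dvd_trans (dvd_mul_right _ _) hmb
  have hqb : q ∣ b := dvd_trans (dvd_mul_left _ _) hmb
  have h32b : 32 ∣ b := by
    have : (32 : ℕ) = 2 ^ 5 := by norm_num
    rw [this]
    exact dvd_trans (pow_dvd_pow 2 hk5) hm₂b
  have habc0 : a * b * c ≠ 0 := Nat.mul_ne_zero (Nat.mul_ne_zero ha0.ne' hb0.ne') hc0.ne'
  obtain ⟨W, hW, hss, hN, hD⟩ := exists_frey_curve ⟨ha0, hb0, hsumabc, hcop⟩ ha2 h32b
  refine ⟨W, hW, hss, ?_, ?_, ?_⟩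
  · -- `y < q ≤ N`
    rw [hN]
    have hrad0' : 0 < rad a b c := by rw [rad_def]; exact Nat.radical_pos _
    exact lt_of_lt_of_le hyq (Nat.le_of_dvd hrad0' (dvd_rad_of_prime_dvd hq hqb habc0))
  · -- `log N ≤ ϑ(y) + y² ≤ y² + 2y`
    rw [hN]
    have h2m₂ : 2 ≤ m₂ := by
      rw [hm₂]
      calc (2 : ℕ) = 2 ^ 1 := by norm_num
        _ ≤ 2 ^ k := Nat.pow_le_pow_right two_pos (by omega)
    have hradQb : rad a b c ≤ Q * b := by
      have : rad a b c * 2 ≤ 2 * (Q * b) :=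
        calc rad a b c * 2 ≤ rad a b c * m₂ := Nat.mul_le_mul_left _ h2m₂
          _ ≤ 2 * Q * b := hkey
          _ = 2 * (Q * b) := by ring
      omega
    have hbX : (b : ℝ) ≤ X := le_trans (by exact_mod_cast (hbc.le.trans hcT)) hTX
    have hrad1 : 1 ≤ rad a b c := by rw [rad_def]; exact Nat.radical_pos _
    have hrad0 : (0 : ℝ) < rad a b c := by exact_mod_cast hrad1
    have hQ0R : (0 : ℝ) < Q := by exact_mod_cast hQpos
    have hb0R : (0 : ℝ) < b := by exact_mod_cast hb0
    have h1 : (rad a b c : ℝ) ≤ Q * b := by exact_mod_cast hradQb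
    have h2 : Real.log (rad a b c) ≤ Real.log Q + Real.log b := by
      have := Real.log_le_log hrad0 h1
      rwa [Real.log_mul hQ0R.ne' hb0R.ne'] at this
    have h3 : Real.log b ≤ yr ^ 2 := by
      have := Real.log_le_log hb0R hbX
      rwa [hlogX] at this
    linarith
  · -- the main inequality
    have hrad1 : 1 ≤ rad a b c := by rw [rad_def]; exact Nat.radical_pos _
    have hrad0 : (0 : ℝ) < rad a b c := by exact_mod_cast hrad1
    have hQ0R : (0 : ℝ) < Q := by exact_mod_cast hQpos
    have hb0R : (0 : ℝ) < b := by exact_mod_cast hb0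
    have hm₂0R : (0 : ℝ) < m₂ := by exact_mod_cast hm₂0
    -- `log b − log rad ≥ log m₂ − log 2 − log Q`
    have hkeyR : (rad a b c : ℝ) * m₂ ≤ 2 * Q * b := by exact_mod_cast hkey
    have hlogkey : Real.log (rad a b c) + Real.log m₂ ≤ Real.log 2 + Real.log Q + Real.log b := by
      have := Real.log_le_log (by positivity) hkeyR
      rwa [Real.log_mul hrad0.ne' hm₂0R.ne', Real.log_mul (by positivity) hb0R.ne',
        Real.log_mul two_ne_zero hQ0R.ne'] at this
    -- `log m₂ > log NS − log 4 − log U ≥ log B − log 4 − log U`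
    have hlogm₂ : Real.log NS < Real.log 4 + Real.log m₂ + Real.log U := by
      have := Real.log_lt_log hNS0R hNSlt
      rwa [Real.log_mul (by positivity) hU0R.ne', Real.log_mul (by norm_num) hm₂0R.ne'] at this
    have hlogNS : Real.log B ≤ Real.log NS := Real.log_le_log hB0 hBN
    -- `log B − ϑ ≥ (2 − 4.5 ε) Y − 2`
    have hf2 : ((1 - ε) * Y - 1) * (1 - ε) ≤ (πy - 1) * (1 - ε) :=
      mul_le_mul_of_nonneg_right (by linarith) (by linarith)
    have hε2Y : 0 ≤ ε ^ 2 * Y := by positivity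
    have hBθ : (2 - 4.5 * ε) * Y - 2 ≤ Real.log B - Chebyshev.theta yr := by
      rw [hnR] at hlogBge
      linarith [hlogBge, hE3, hf2, hε2Y, hLY, hL4, hε, hY0]
    -- `log b − log rad ≥ (2 − 7.5 ε) Y − 6.2`
    have hl2 : Real.log 2 < 0.7 := by have := Real.log_two_lt_d9; linarith
    have hbrad : (2 - 7.5 * ε) * Y - 6.2 ≤ Real.log b - Real.log (rad a b c) := by
      linarith [hlogkey, hlogm₂, hlogNS, hBθ, hlogU, hlogQ, hl4, hl2, hLY]
    -- `log Δ = 2 log(abc) − log 256 ≥ 6 log b − log 256`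
    have habcR : ((a * b * c : ℕ) : ℝ) ^ 2 = 256 * (W.minimalDiscriminantNorm ℤ : ℝ) := by
      have : ((2 ^ 8 * W.minimalDiscriminantNorm ℤ : ℕ) : ℝ) = (((a * b * c) ^ 2 : ℕ) : ℝ) := by
        exact_mod_cast hD
      push_cast at this ⊢
      linarith
    have habc0R : (0 : ℝ) < ((a * b * c : ℕ) : ℝ) := by exact_mod_cast Nat.pos_of_ne_zero habc0
    have hD0 : (0 : ℝ) < (W.minimalDiscriminantNorm ℤ : ℝ) := by
      have : (0 : ℝ) < ((a * b * c : ℕ) : ℝ) ^ 2 := by positivity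
      linarith
    have hlogD : Real.log (W.minimalDiscriminantNorm ℤ : ℝ) =
        2 * Real.log ((a * b * c : ℕ) : ℝ) - Real.log 256 := by
      have := congrArg Real.log habcR
      rw [Real.log_pow, Real.log_mul (by norm_num) hD0.ne'] at this
      simp only [Nat.cast_ofNat] at this
      linarith
    have hb3 : 3 * Real.log b ≤ Real.log ((a * b * c : ℕ) : ℝ) := by
      have h1 : ((b ^ 3 : ℕ) : ℝ) ≤ ((a * b * c : ℕ) : ℝ) := by
        have : b ^ 3 ≤ a * b * c :=
          calc b ^ 3 = b * b * b := by ring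
            _ ≤ a * b * c := by gcongr
        exact_mod_cast this
      have := Real.log_le_log (by positivity) h1
      rw [Nat.cast_pow, Real.log_pow] at this
      exact_mod_cast this
    -- assemble: `η Y = 64 ε Y ≥ 256`
    have hηY : η * Y = 64 * (ε * Y) := by rw [hεdef]; ring
    have hmain : 6 * Real.log (rad a b c) + (12 - η) * Y ≤
        Real.log (W.minimalDiscriminantNorm ℤ : ℝ) := by
      rw [hlogD]
      linarith [hbrad, hb3, hl256, hηY, hεY4, hε, hY0]
    have hE : (12 - η) * yr / L = (12 - η) * Y := by rw [hY, mul_div_assoc]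
    rw [hN, hE]
    exact hmain


/-! ### Masser's Theorem -/

set_option maxHeartbeats 800000 in
open StewartTijdeman in
/-- **Masser (1990), Theorem — PROVED (the statement of the catalogue's `masser1990_theorem`).**
For every `δ > 0` and `N₀` there is a (semistable) elliptic curve `E/ℚ` with conductor `N > N₀` and
`|Δ_min(E)| ≥ N^6 exp((24 − δ)(log N)^{1/2}(log log N)^{−1})`. From `exists_curve_quant` with
`η = min(δ, 4)/4`: there `log|Δ_min| ≥ 6 log N + (12 − η) y/log y` and `log N ≤ y² + 2y`,
`N > y`, so that, by the monotonicity of `u ↦ √u/log u` on `[e², ∞)`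
(`StewartTijdeman.sqrt_div_log_mono`), `√(log N)/log log N ≤ (y + 1)/(2 log y)` and
`(24 − δ)√(log N)/log log N ≤ (12 − 2η) y/log y + 3 ≤ (12 − η) y/log y` once `η y/log y ≥ 3`.
[cite: Masser1990, Theorem] -/
theorem masser_theorem (δ : ℝ) (hδ : 0 < δ) (N₀ : ℕ) :
    ∃ W : WeierstrassCurve ℚ, W.IsElliptic ∧ W.IsSemistable ℤ ∧ N₀ < W.conductorNorm ℤ ∧
      (W.conductorNorm ℤ : ℝ) ^ 6 *
          Real.exp ((24 - δ) * Real.log (W.conductorNorm ℤ) ^ (1 / 2 : ℝ) *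
            (Real.log (Real.log (W.conductorNorm ℤ)))⁻¹) ≤
        (W.minimalDiscriminantNorm ℤ : ℝ) := by
  -- `η = min(δ, 4)/4 ∈ (0, 1]`, `24 − δ ≤ 24 − 4η`
  set η : ℝ := min δ 4 / 4 with hηdef
  have hη : 0 < η := by rw [hηdef]; positivity
  have hη1 : η ≤ 1 := by
    rw [hηdef]; have := min_le_right δ 4; linarith
  have hδη : 24 - δ ≤ 24 - 4 * η := by
    rw [hηdef]; have := min_le_left δ 4; linarith
  obtain ⟨y₀, hy₀⟩ := exists_curve_quant hη hη1
  have hη3 : 0 < η / 3 := by positivity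
  obtain ⟨y₂, hy₂⟩ := Filter.eventually_atTop.mp
    ((eventually_log_sq_le hη3).and (eventually_ge_atTop (Real.exp (Real.exp 2))))
  set y : ℕ := max (max y₀ N₀) (max ⌈y₂⌉₊ 3) with hydef
  have hyy₀ : y₀ ≤ y := le_trans (le_max_left _ _) (le_max_left _ _)
  have hyN₀ : N₀ ≤ y := le_trans (le_max_right _ _) (le_max_left _ _)
  have hy3 : 3 ≤ y := le_trans (le_max_right _ _) (le_max_right _ _)
  have hyy₂ : y₂ ≤ (y : ℝ) :=
    le_trans (Nat.le_ceil y₂) (by exact_mod_cast le_trans (le_max_left _ _) (le_max_right _ _))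
  obtain ⟨hlog2, hyee⟩ := hy₂ y hyy₂
  obtain ⟨W, hW, hss, hyN, hlogN, hmain⟩ := hy₀ y hyy₀
  refine ⟨W, hW, hss, lt_of_le_of_lt hyN₀ hyN, ?_⟩
  -- notation and positivity
  set N : ℝ := (W.conductorNorm ℤ : ℝ) with hNdef
  set D : ℝ := (W.minimalDiscriminantNorm ℤ : ℝ) with hDdef
  set yr : ℝ := (y : ℝ) with hyr
  set L : ℝ := Real.log yr with hL
  have hyr3 : (3 : ℝ) ≤ yr := by rw [hyr]; exact_mod_cast hy3
  have hyr0 : 0 < yr := by linarith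
  have hee0 : 0 < Real.exp (Real.exp 2) := Real.exp_pos _
  have he2 : 4 ≤ Real.exp 2 := by
    have h1 : Real.exp 2 = Real.exp 1 * Real.exp 1 := by rw [← Real.exp_add]; norm_num
    have h2 := Real.exp_one_gt_d9
    nlinarith
  have hL4 : 4 ≤ L := by
    have := Real.log_le_log hee0 hyee
    rw [Real.log_exp] at this
    rw [hL]; linarith
  have hL1 : 1 ≤ L := by linarith
  have hL0 : 0 < L := by linarith
  have hyrN : yr < N := by rw [hyr, hNdef]; exact_mod_cast hyN
  have hNpos : 0 < N := by linarith
  have hN1 : 1 < N := by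
    have : (1 : ℝ) < Real.exp (Real.exp 2) := by
      have h := Real.add_one_le_exp (Real.exp 2); have := Real.exp_pos 2; linarith
    linarith
  have hlogNpos : 0 < Real.log N := Real.log_pos hN1
  -- `e² ≤ log N ≤ y² + 2y`
  have hlogNge : Real.exp 2 ≤ Real.log N := by
    rw [← Real.log_exp (Real.exp 2)]
    exact Real.log_le_log hee0 (by linarith)
  have hloglogN : 2 ≤ Real.log (Real.log N) := by
    rw [← Real.log_exp 2]; exact Real.log_le_log (Real.exp_pos 2) hlogNge
  have hloglogN0 : 0 < Real.log (Real.log N) := by linarith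
  -- `D > 0`
  have hY0 : 0 < (12 - η) * yr / L := by
    have : 0 < 12 - η := by linarith
    positivity
  have hD0 : 0 < D := by
    rcases Nat.eq_zero_or_pos (W.minimalDiscriminantNorm ℤ) with h | h
    · exfalso
      have : Real.log D = 0 := by rw [hDdef, h]; simp
      rw [this] at hmain
      linarith [hmain, hlogNpos, hY0]
    · rw [hDdef]; exact_mod_cast h
  -- `√(log N)/log log N ≤ (y + 1)/(2L)`
  have hv : Real.log N ≤ yr ^ 2 + 2 * yr := hlogN
  have hmono := sqrt_div_log_mono hlogNge hv
  have hsqrt : Real.sqrt (yr ^ 2 + 2 * yr) ≤ yr + 1 := by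
    rw [Real.sqrt_le_left (by linarith)]
    have : (yr + 1) ^ 2 = yr ^ 2 + 2 * yr + 1 := by ring
    linarith
  have hlogv : 2 * L ≤ Real.log (yr ^ 2 + 2 * yr) := by
    have e : Real.log (yr ^ 2) = 2 * L := by rw [hL, Real.log_pow]; norm_num
    rw [← e]
    exact Real.log_le_log (by positivity) (by linarith)
  have hlogv0 : 0 < Real.log (yr ^ 2 + 2 * yr) := by linarith
  have hf : Real.sqrt (Real.log N) / Real.log (Real.log N) ≤ (yr + 1) / (2 * L) := by
    calc Real.sqrt (Real.log N) / Real.log (Real.log N)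
        ≤ Real.sqrt (yr ^ 2 + 2 * yr) / Real.log (yr ^ 2 + 2 * yr) := hmono
      _ ≤ (yr + 1) / (2 * L) := by
          rw [div_le_div_iff₀ hlogv0 (by positivity)]
          calc Real.sqrt (yr ^ 2 + 2 * yr) * (2 * L) ≤ (yr + 1) * (2 * L) :=
                mul_le_mul_of_nonneg_right hsqrt (by positivity)
            _ ≤ (yr + 1) * Real.log (yr ^ 2 + 2 * yr) :=
                mul_le_mul_of_nonneg_left hlogv (by linarith)
  have hf0 : 0 ≤ Real.sqrt (Real.log N) / Real.log (Real.log N) := by positivity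
  -- `η y/log y ≥ 3`: from `(log y)² ≤ (η/3) y` and `log y ≥ 1`
  have hηY : 3 ≤ η * yr / L := by
    rw [le_div_iff₀ hL0]
    have h1 : L * L ≤ η / 3 * yr := by rw [← sq]; exact hlog2
    have h2 : L ≤ L * L := le_mul_of_one_le_right hL0.le hL1
    linarith
  -- the exponent comparison
  have hE : (24 - δ) * Real.log N ^ (1 / 2 : ℝ) * (Real.log (Real.log N))⁻¹ ≤
      (12 - η) * yr / L := by
    have e1 : Real.log N ^ (1 / 2 : ℝ) * (Real.log (Real.log N))⁻¹ =
        Real.sqrt (Real.log N) / Real.log (Real.log N) := by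
      rw [Real.sqrt_eq_rpow]; ring
    rw [mul_assoc, e1]
    calc (24 - δ) * (Real.sqrt (Real.log N) / Real.log (Real.log N))
        ≤ (24 - 4 * η) * (Real.sqrt (Real.log N) / Real.log (Real.log N)) :=
          mul_le_mul_of_nonneg_right hδη hf0
      _ ≤ (24 - 4 * η) * ((yr + 1) / (2 * L)) :=
          mul_le_mul_of_nonneg_left hf (by linarith)
      _ = (12 - 2 * η) * yr / L + (12 - 2 * η) / L := by field_simp; ring
      _ ≤ (12 - 2 * η) * yr / L + 3 := by
          have : (12 - 2 * η) / L ≤ 3 := by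
            rw [div_le_iff₀ hL0]; linarith
          linarith
      _ ≤ (12 - η) * yr / L := by
          have e2 : (12 - η) * yr / L = (12 - 2 * η) * yr / L + η * yr / L := by ring
          rw [e2]; linarith
  -- conclusion
  have hexp : 6 * Real.log N + (24 - δ) * Real.log N ^ (1 / 2 : ℝ) * (Real.log (Real.log N))⁻¹ ≤
      Real.log D := by
    have := hmain
    linarith
  calc N ^ 6 * Real.exp ((24 - δ) * Real.log N ^ (1 / 2 : ℝ) * (Real.log (Real.log N))⁻¹)
      = Real.exp (6 * Real.log N +
          (24 - δ) * Real.log N ^ (1 / 2 : ℝ) * (Real.log (Real.log N))⁻¹) := by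
        have e : Real.exp (6 * Real.log N) = N ^ 6 := by
          have : 6 * Real.log N = Real.log (N ^ 6) := by rw [Real.log_pow]; norm_num
          rw [this, Real.exp_log (by positivity)]
        rw [Real.exp_add, e]
    _ ≤ Real.exp (Real.log D) := Real.exp_le_exp.mpr hexp
    _ = D := Real.exp_log hD0

end Masser

/-! ### The catalogue's iso-class rendering `masser1990_lowerBound` -/

open Masser in
/-- **Discharge of the named fact `masser1990_lowerBound` (Masser 1990, Theorem, in the
iso-class form reported by Bennett–Yazdani (2012), eq. (6)).** For every `δ > 0` and every finite
set `S` of Weierstrass equations there is an elliptic `W/ℚ`, not a `VariableChange ℚ`-transform of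
any member of `S`, with `N^6 exp((24 − δ)(log N)^{1/2}(log log N)^{−1}) ≤ |Δ_min|`: take Masser's
curve (`Masser.masser_theorem`) with conductor exceeding every conductor occurring in `S`; the
conductor is an isomorphism invariant
(`WeierstrassCurve.conductorNorm_smul_rat`).
[cite: Masser1990, Theorem] [cite: BennettYazdani2012, §7 eq. (6)] -/
theorem masser1990_lowerBound_holds : masser1990_lowerBound := by
  intro δ hδ S
  obtain ⟨W, hW, -, hN, hbound⟩ := masser_theorem δ hδ (S.sup fun W' => W'.conductorNorm ℤ)
  refine ⟨W, hW, ?_, hbound⟩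
  intro W' hW' C hC
  haveI := hW
  haveI : W'.IsElliptic := by
    have e : C⁻¹ • (C • W') = W' := inv_smul_smul C W'
    rw [hC] at e
    rw [← e]
    infer_instance
  have hnorm : W.conductorNorm ℤ = W'.conductorNorm ℤ := by
    rw [← hC]; exact WeierstrassCurve.conductorNorm_smul_rat W' C
  have hle : W'.conductorNorm ℤ ≤ S.sup fun W' => W'.conductorNorm ℤ :=
    Finset.le_sup (f := fun W' => W'.conductorNorm ℤ) hW'
  omega

end Literature.Barriers.ABC

end
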